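import Literature.NumberTheory.Rogawski1990.ArchOrbFamGExtRealWallContinuous    -- ★ p850625∕p850640 (F0P3b-p01 (g15)) (B) order 0: binders, `orbFamGExt_eqOn_realWall_of_block`, glue; brings ★ p850511, ★ p850462, ★ p850413
import Literature.NumberTheory.Automorphic.ArchRankOneSplitOrbitSmooth           -- ★ p850603 (this seat) (A0-smooth): `contDiff_integral_prod_conj_hypBlockGL_half_param`
import Literature.NumberTheory.Automorphic.ArchInnerFormChartOrbitalSmooth       -- ★ p850500∕p850509 (this seat): `cexp_add_mul_I_sub_cexp_mul_I_ne_zero`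
import HarnessLib

/-!
# (B∞): the wall-extended orbital family `orbFamGExt` of `G′_∞` is `C^∞` ACROSS THE REAL WALL `x_w = 0` (binder form, all orders)
# (Harish-Chandra ∕ Varadarajan 1977 I §1.12, 1989 §6.4; Rogawski 1990 §8.2; Shelstad 1979 §4; Bouaziz 1994 §3.1 (I₂))

Topic `NumberTheory/Rogawski1990`; namespace `Literature.NumberTheory.Rogawski1990`.  THEOREMS ONLY (no `def`, no instance, no notation, no axiom, no named fact, no `sorry`).
Cell `pub/hodgecm-mathlib`, crux H413 (`stmt-HodgeConjecture-24833`), line LH3 (closer stub `stub_N9`, direct road), LETTER L1 `HcOrbitalFamiliesStatement` clause (I₂)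
`ContDiffOn ℝ ∞ (F S′) (InRegG s S′)` at the REAL WALLS, ALL ORDERS — the `ContDiffOn` twin of ★ (B) `ArchOrbFamGExtRealWallContinuous` (p850625∕p850640, F0P3b-p01 (g15), order 0),
over the all-orders rank-one engine ★ (A0-smooth) p850603 and the smooth readings ★ (aM-SMOOTH) p850672, ★ (eM-SMOOTH) p850755 (seat F0P3a-p05 (g20); hand-over F0P3b-p01 (g16)
2026-09-02T09:16:35Z «= p05, GO»; LH3-plan (g3) 09:15:41Z).  Count-neutral.

THE MATHEMATICS.  In the binder currency of ★ p850625 (descent `hdesc` at the wall point `s`, block data `eM Ψ hΨ`, `Ψ_* μZ = κ • μ`, `μ = C • ((k,n) ↦ ⟦kn⟧)_*(κ_K ⊗ μ_N)`, joint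
chart reading `eM γ_c = (hypBlockGL x_c ϑ(c), ρ(c))` on `U`), the value of the family on `U ∩ InRegG` is `cof(c) · (C₀κ) · (C • ∫_{K×N} aM(eM⁻¹(k·(e^{iϑ(c)} a(x_c∕2) n a(x_c∕2))·k⁻¹, ρ(c))))`
(★ `orbFamGExt_eqOn_realWall_of_block`).  With the SMOOTH READINGS `aM = ΘM ∘ (↑↑↑·)`, `↑↑↑(eM⁻¹(b,1)) = Λ(↑↑b)`, `↑↑↑(eM⁻¹(1,ρ c)) = Rρ(c)`, `ϑ` smooth, the block test
function is `b ↦ ΘM(Λ(↑↑b) · Rρ(c))`, the restriction of the smooth ambient `f(c, B) = ΘM(Λ B · Rρ c)`, so ★ (A0-smooth) `contDiff_integral_prod_conj_hypBlockGL_half_param` makes the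
cone chart `C^∞` in `c` (§2 `contDiff_coneChart_of_smooth`); the cofactor `cof` is `C^∞` off the codimension-two corner `x_w = 0 ∧ e^{iθ₂} = e^{iθ₁}` and off the other real walls
(§1 `contDiffOn_splitCofactor`); hence **`contDiffOn_orbFamGExt_realWall_of_block_of_smooth : ContDiffOn ℝ ∞ (orbFamGExt L α ν′ a′ (S ∪ {w})) ((U ∩ {cof-regular}) ∩ InRegG …)`**
— NO singularity of any order on the split Cartan's real wall (Harish-Chandra: `'F_f` is smooth across `x = 0`; the jumps live on the compact Cartan's noncompact walls, organ J).
HONEST LABEL: binder form; the dischargers are ★ ((SPLIT-DOCK) p850470 for `hdesc`, (M-UNFOLD) p850446∕p850499∕p850544 for `eM Ψ hΨ hγ`, p850672∕p850755 for the readings); the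
corner `x_w = 0 ∧ e^{iθ₂} = e^{iθ₁}` and the simultaneous real walls of two split places are NOT covered (F0P3b-p01 (g16)'s (B-corner)∕(B-scalar) census).  HC_CM is proved only
modulo the printed citations (2 remaining named inputs: hLiu418 = `stmt-HodgeConjecture-24832`, h413 = `stmt-HodgeConjecture-24833`) until rung 0 closes.

## References
* [Varadarajan1977] V. S. Varadarajan, *Harmonic Analysis on Real Reductive Groups*, LNM 576 (1977), Part I §1.12.
* [Varadarajan1989] V. S. Varadarajan, *An Introduction to Harmonic Analysis on Semisimple Lie Groups* (1989), §6.4 Lemma 21, Thm 23.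
* [Rogawski1990] J. D. Rogawski, *Automorphic Representations of Unitary Groups in Three Variables*, Ann. of Math. Stud. 123 (1990), §8.2 pp. 118–122, §4.12 Lemma 4.12.1 p. 66.
* [Shelstad1979] D. Shelstad, *Characters and inner forms of a quasi-split group over ℝ*, Compositio Math. 39 (1979), §4 pp. 22–25, Lemma 4.3.
* [Bouaziz1994IntegralesOrbitales] A. Bouaziz, *Intégrales orbitales sur les groupes de Lie réductifs*, Ann. Sci. ÉNS 27 (1994), §3.1 (I₂) p. 579.
* [HormanderALPDO1] L. Hörmander, *The Analysis of Linear Partial Differential Operators I* (1990), Thm. 1.1.9.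
-/

set_option autoImplicit false

noncomputable section

open MeasureTheory MeasureTheory.Measure Matrix NumberField NumberField.InfinitePlace NumberField.mixedEmbedding Set Filter Function Topology Complex
open Literature.MeasureTheory.Group Literature.NumberTheory.Automorphic Literature.NumberTheory.Automorphic.UnitaryGroup Literature.NumberTheory.Automorphic.ArchCartan
open scoped MatrixGroups Matrix ContDiff NNReal Classical
open scoped Matrix.Norms.Operator

namespace Literature.NumberTheory.Rogawski1990

/-! ## §1 The split-chart cofactor is smooth where its complex-pair and real-root factors do not vanish -/

section Cofactor

variable {W : Type*} [Fintype W] [DecidableEq W]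

/-- **The cofactor `C(c)` of `R′_{S∪w} = |e^{x_w} − e^{−x_w}| · C` is `C^∞` on the set where the complex-pair factor at `w` and the real-root factors at the OTHER split places do
not vanish** (`e^{±x+iθ} ≠ e^{iφ}` at `w`; `x_{w′} ≠ 0` at `w′ ∈ S ∖ {w}`): norms are smooth off `0`, `|·|` is smooth off `0`, the compact-place factors are entire.
[cite: Shelstad1979, §4 p. 22] [cite: Rogawski1990, §8.2 p. 118] -/
theorem contDiffOn_splitCofactor (S : Finset W) (w : W) :
    ContDiffOn ℝ ∞ (fun c : W → Fin 3 → ℝ =>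
      ((‖Complex.exp (c w 0 + c w 2 * I) - Complex.exp (c w 1 * I)‖ * ‖Complex.exp (-c w 0 + c w 2 * I) - Complex.exp (c w 1 * I)‖ : ℝ) : ℂ) *
        ∏ w' ∈ Finset.univ.erase w,
          (if w' ∈ insert w S then
              ((|Real.exp (c w' 0) - Real.exp (-c w' 0)| *
                ‖Complex.exp (c w' 0 + c w' 2 * I) - Complex.exp (c w' 1 * I)‖ * ‖Complex.exp (-c w' 0 + c w' 2 * I) - Complex.exp (c w' 1 * I)‖ : ℝ) : ℂ)
            else (1 - (Circle.exp (c w' 1 - c w' 0) : ℂ)) * (1 - (Circle.exp (c w' 2 - c w' 0) : ℂ)) * (1 - (Circle.exp (c w' 2 - c w' 1) : ℂ))))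
      {c | Complex.exp (c w 0 + c w 2 * I) ≠ Complex.exp (c w 1 * I) ∧ Complex.exp (-c w 0 + c w 2 * I) ≠ Complex.exp (c w 1 * I) ∧
        ∀ w', w' ∈ S → w' ≠ w → c w' 0 ≠ 0} := by
  have hco : ∀ (w' : W) (i : Fin 3), ContDiff ℝ ∞ fun c : W → Fin 3 → ℝ => c w' i := fun w' i => contDiff_apply_apply ℝ ℝ w' i
  have hcoC : ∀ (w' : W) (i : Fin 3), ContDiff ℝ ∞ fun c : W → Fin 3 → ℝ => ((c w' i : ℝ) : ℂ) := fun w' i => ofRealCLM.contDiff.comp (hco w' i)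
  have hz₁ : ∀ w' : W, ContDiff ℝ ∞ fun c : W → Fin 3 → ℝ => Complex.exp (c w' 0 + c w' 2 * I) - Complex.exp (c w' 1 * I) := fun w' =>
    (Complex.contDiff_exp.comp ((hcoC w' 0).add ((hcoC w' 2).mul contDiff_const))).sub (Complex.contDiff_exp.comp ((hcoC w' 1).mul contDiff_const))
  have hz₂ : ∀ w' : W, ContDiff ℝ ∞ fun c : W → Fin 3 → ℝ => Complex.exp (-c w' 0 + c w' 2 * I) - Complex.exp (c w' 1 * I) := fun w' =>
    (Complex.contDiff_exp.comp ((hcoC w' 0).neg.add ((hcoC w' 2).mul contDiff_const))).sub (Complex.contDiff_exp.comp ((hcoC w' 1).mul contDiff_const))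
  have hg : ∀ w' : W, ContDiff ℝ ∞ fun c : W → Fin 3 → ℝ => Real.exp (c w' 0) - Real.exp (-c w' 0) := fun w' =>
    (Real.contDiff_exp.comp (hco w' 0)).sub (Real.contDiff_exp.comp (hco w' 0).neg)
  have hcirc : ∀ (w' : W) (i j : Fin 3), ContDiff ℝ ∞ fun c : W → Fin 3 → ℝ => (1 - (Circle.exp (c w' i - c w' j) : ℂ)) := by
    intro w' i j
    have h : (fun c : W → Fin 3 → ℝ => (Circle.exp (c w' i - c w' j) : ℂ)) = fun c => Complex.exp (((c w' i - c w' j : ℝ) : ℂ) * I) :=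
      funext fun c => Circle.coe_exp _
    refine contDiff_const.sub ?_
    rw [h]
    exact Complex.contDiff_exp.comp ((ofRealCLM.contDiff.comp ((hco w' i).sub (hco w' j))).mul contDiff_const)
  intro c hc
  obtain ⟨h1, h2, hS⟩ := hc
  -- the pair factor at `w`
  have hA : ContDiffAt ℝ ∞ (fun c : W → Fin 3 → ℝ =>
      ((‖Complex.exp (c w 0 + c w 2 * I) - Complex.exp (c w 1 * I)‖ * ‖Complex.exp (-c w 0 + c w 2 * I) - Complex.exp (c w 1 * I)‖ : ℝ) : ℂ)) c :=
    ofRealCLM.contDiff.contDiffAt.comp c (((hz₁ w).contDiffAt.norm ℝ (sub_ne_zero.2 h1)).mul ((hz₂ w).contDiffAt.norm ℝ (sub_ne_zero.2 h2)))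
  refine (hA.mul ?_).contDiffWithinAt
  refine contDiffAt_prod (fun w' hw' => ?_)
  have hne : w' ≠ w := (Finset.mem_erase.1 hw').1
  by_cases hwS : w' ∈ insert w S
  · simp only [hwS, if_true]
    have hw'S : w' ∈ S := (Finset.mem_insert.1 hwS).resolve_left hne
    have hx : c w' 0 ≠ 0 := hS w' hw'S hne
    have hne₀ : Real.exp (c w' 0) - Real.exp (-c w' 0) ≠ 0 := by
      intro h0
      have h' : c w' 0 = -c w' 0 := Real.exp_injective (sub_eq_zero.1 h0)
      exact hx (by linarith)
    have hne₁ : Complex.exp ((c w' 0 : ℂ) + (c w' 2 : ℂ) * I) - Complex.exp ((c w' 1 : ℂ) * I) ≠ 0 := cexp_add_mul_I_sub_cexp_mul_I_ne_zero hx _ _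
    have hne₂ : Complex.exp (-(c w' 0 : ℂ) + (c w' 2 : ℂ) * I) - Complex.exp ((c w' 1 : ℂ) * I) ≠ 0 := by
      have h := cexp_add_mul_I_sub_cexp_mul_I_ne_zero (neg_ne_zero.2 hx) (c w' 2) (c w' 1)
      simpa using h
    exact ofRealCLM.contDiff.contDiffAt.comp c ((((hg w').contDiffAt.abs hne₀).mul ((hz₁ w').contDiffAt.norm ℝ hne₁)).mul ((hz₂ w').contDiffAt.norm ℝ hne₂))
  · simp only [hwS, if_false]
    exact (((hcirc w' 1 0).mul (hcirc w' 2 0)).mul (hcirc w' 2 1)).contDiffAt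

omit [Fintype W] in
/-- The cofactor-regular set is OPEN. [cite: Shelstad1979, §4 p. 22] -/
theorem isOpen_setOf_splitCofactor_ne_zero (S : Finset W) (w : W) :
    IsOpen {c : W → Fin 3 → ℝ | Complex.exp (c w 0 + c w 2 * I) ≠ Complex.exp (c w 1 * I) ∧ Complex.exp (-c w 0 + c w 2 * I) ≠ Complex.exp (c w 1 * I) ∧
        ∀ w', w' ∈ S → w' ≠ w → c w' 0 ≠ 0} := by
  have hco : ∀ (w' : W) (i : Fin 3), Continuous fun c : W → Fin 3 → ℝ => ((c w' i : ℝ) : ℂ) := fun w' i =>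
    Complex.continuous_ofReal.comp ((continuous_apply i).comp (continuous_apply w'))
  refine (isOpen_ne_fun (Complex.continuous_exp.comp ((hco w 0).add ((hco w 2).mul continuous_const))) (Complex.continuous_exp.comp ((hco w 1).mul continuous_const))).inter
    ((isOpen_ne_fun (Complex.continuous_exp.comp ((hco w 0).neg.add ((hco w 2).mul continuous_const))) (Complex.continuous_exp.comp ((hco w 1).mul continuous_const))).inter ?_)
  have he : {c : W → Fin 3 → ℝ | ∀ w', w' ∈ S → w' ≠ w → c w' 0 ≠ 0} = ⋂ w' ∈ S.erase w, {c | c w' 0 ≠ 0} := by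
    ext c
    simp only [Set.mem_setOf_eq, Set.mem_iInter, Finset.mem_erase]
    exact ⟨fun h w' hw' => h w' hw'.2 hw'.1, fun h w' hw'S hne => h w' ⟨hne, hw'S⟩⟩
  have hopen : IsOpen {c : W → Fin 3 → ℝ | ∀ w', w' ∈ S → w' ≠ w → c w' 0 ≠ 0} := by
    rw [he]
    exact isOpen_biInter_finset fun w' _ => isOpen_ne_fun ((continuous_apply 0).comp (continuous_apply w')) continuous_const
  exact hopen

end Cofactor

end Literature.NumberTheory.Rogawski1990

/-! ## §2 The cone chart with SMOOTH readings is `C^∞` (★ (A0-smooth) engine); §3 the head: `orbFamGExt` is `C^∞` across the real wall -/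

namespace Literature.NumberTheory.Rogawski1990

section JointChartSmooth

variable (L : Type) [Field L] [NumberField L] [IsCMField L] (α : Fin 3 → L)
  [MeasurableSpace ↥(arch (↥(maximalRealSubfield L)) L (IsCMField.complexConj L) 3 (Matrix.diagonal α))] [BorelSpace ↥(arch (↥(maximalRealSubfield L)) L (IsCMField.complexConj L) 3 (Matrix.diagonal α))]
  (ν' : Measure ↥(arch (↥(maximalRealSubfield L)) L (IsCMField.complexConj L) 3 (Matrix.diagonal α))) [ν'.IsHaarMeasure] [ν'.IsMulRightInvariant]
  (a' : ↥(arch (↥(maximalRealSubfield L)) L (IsCMField.complexConj L) 3 (Matrix.diagonal α)) → ℂ)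
  (S : Finset {w : InfinitePlace L // IsComplex w}) (w : {w : InfinitePlace L // IsComplex w})
  (s : ↥(arch (↥(maximalRealSubfield L)) L (IsCMField.complexConj L) 3 (Matrix.diagonal α)))
  (hT : chartTorusG L α (insert w S) ≤ Subgroup.centralizer ({s} : Set ↥(arch (↥(maximalRealSubfield L)) L (IsCMField.complexConj L) 3 (Matrix.diagonal α))))
  [MeasurableSpace (↥(Subgroup.centralizer ({s} : Set ↥(arch (↥(maximalRealSubfield L)) L (IsCMField.complexConj L) 3 (Matrix.diagonal α)))) ⧸ (chartTorusG L α (insert w S)).subgroupOf (Subgroup.centralizer ({s} : Set ↥(arch (↥(maximalRealSubfield L)) L (IsCMField.complexConj L) 3 (Matrix.diagonal α)))))]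
  [BorelSpace (↥(Subgroup.centralizer ({s} : Set ↥(arch (↥(maximalRealSubfield L)) L (IsCMField.complexConj L) 3 (Matrix.diagonal α)))) ⧸ (chartTorusG L α (insert w S)).subgroupOf (Subgroup.centralizer ({s} : Set ↥(arch (↥(maximalRealSubfield L)) L (IsCMField.complexConj L) 3 (Matrix.diagonal α)))))]
  {J : Matrix (Fin 2) (Fin 2) ℂ} (hJ : J = (StdForm.antidiagonal 2).over ℂ)
  [MeasurableSpace ↥(unitaryGroupOfForm (starRingEnd ℂ) J)] [BorelSpace ↥(unitaryGroupOfForm (starRingEnd ℂ) J)]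
  {K : Subgroup ↥(unitaryGroupOfForm (starRingEnd ℂ) J)} (κK : Measure ↥K) (μN : Measure ↥(unipotentU (starRingEnd ℂ) J))
  [MeasurableSpace (↥(unitaryGroupOfForm (starRingEnd ℂ) J) ⧸ torusU (starRingEnd ℂ) J)] [BorelSpace (↥(unitaryGroupOfForm (starRingEnd ℂ) J) ⧸ torusU (starRingEnd ℂ) J)]
  (μ : Measure (↥(unitaryGroupOfForm (starRingEnd ℂ) J) ⧸ torusU (starRingEnd ℂ) J))
  {R : Type*} [Group R] [TopologicalSpace R]
  (eM : ↥(Subgroup.centralizer ({s} : Set ↥(arch (↥(maximalRealSubfield L)) L (IsCMField.complexConj L) 3 (Matrix.diagonal α)))) ≃ₜ* ↥(unitaryGroupOfForm (starRingEnd ℂ) J) × R)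
  (Ψ : (↥(Subgroup.centralizer ({s} : Set ↥(arch (↥(maximalRealSubfield L)) L (IsCMField.complexConj L) 3 (Matrix.diagonal α)))) ⧸ (chartTorusG L α (insert w S)).subgroupOf (Subgroup.centralizer ({s} : Set ↥(arch (↥(maximalRealSubfield L)) L (IsCMField.complexConj L) 3 (Matrix.diagonal α))))) ≃ₜ ↥(unitaryGroupOfForm (starRingEnd ℂ) J) ⧸ torusU (starRingEnd ℂ) J)
  (hΨ : ∀ b : ↥(unitaryGroupOfForm (starRingEnd ℂ) J), Ψ.symm (QuotientGroup.mk b) = QuotientGroup.mk (eM.symm (b, 1)))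
  {U : Set ({w : InfinitePlace L // IsComplex w} → Fin 3 → ℝ)} {ϑ : ({w : InfinitePlace L // IsComplex w} → Fin 3 → ℝ) → ℝ} {ρ : ({w : InfinitePlace L // IsComplex w} → Fin 3 → ℝ) → R}
  (hγ : ∀ c ∈ U, eM ⟨gprimeTorus L α (insert w S) c, hT (gprimeTorus_mem_chartTorusG L α (insert w S) c)⟩ =
    ((⟨hypBlockGL (c w 0) (ϑ c), hypBlockGL_mem_of_eq_over hJ (c w 0) (ϑ c)⟩ : ↥(unitaryGroupOfForm (starRingEnd ℂ) J)), ρ c))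

omit [MeasurableSpace ↥(arch (↥(maximalRealSubfield L)) L (IsCMField.complexConj L) 3 (Matrix.diagonal α))] [BorelSpace ↥(arch (↥(maximalRealSubfield L)) L (IsCMField.complexConj L) 3 (Matrix.diagonal α))] [MeasurableSpace (↥(unitaryGroupOfForm (starRingEnd ℂ) J) ⧸ torusU (starRingEnd ℂ) J)] [BorelSpace (↥(unitaryGroupOfForm (starRingEnd ℂ) J) ⧸ torusU (starRingEnd ℂ) J)] in
include hJ in
/-- **THE CONE CHART WITH SMOOTH READINGS IS `C^∞`** — the all-orders twin of ★ `continuousOn_coneChart_of_block`: if the descended function reads `aM = ΘM ∘ (↑↑↑·)` with `ΘM` smooth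
on `M₃(L ⊗ ℝ)` (★ (aM-SMOOTH) p850672), the block embedding reads `↑↑↑(eM⁻¹(b, 1)) = Λ(↑↑b)` with `Λ` smooth (★ (eM-SMOOTH) p850755 with ★ p850499 [8]), the spectator reads
`↑↑↑(eM⁻¹(1, ρ c)) = Rρ(c)` with `Rρ` smooth ([10] + the chart, ★ `contDiff_coe_gprimeTorus`) and `ϑ` is smooth, then
**`c ↦ ∫_{K×N} aM(eM⁻¹(k · (e^{iϑ(c)} · a(x_c∕2) n a(x_c∕2)) · k⁻¹, ρ(c))) d(κ_K ⊗ μ_N)` is `C^∞` on the whole coordinate space** — ★ (A0-smooth) `contDiff_integral_prod_conj_hypBlockGL_half_param`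
with the parameter space `Q :=` the coordinates and the ambient function `f (c, B) := ΘM (Λ B · Rρ c)`. [cite: Varadarajan1989, §6.4 Thm 23] [cite: Rogawski1990, §8.2 p. 119]
[cite: HormanderALPDO1, Thm. 1.1.9] -/
theorem contDiff_coneChart_of_smooth (hK : IsCompact (K : Set ↥(unitaryGroupOfForm (starRingEnd ℂ) J))) [IsHaarMeasure κK] [IsHaarMeasure μN]
    {aM : ↥(Subgroup.centralizer ({s} : Set ↥(arch (↥(maximalRealSubfield L)) L (IsCMField.complexConj L) 3 (Matrix.diagonal α)))) → ℂ} (haMs : HasCompactSupport aM)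
    (ΘM : Matrix (Fin 3) (Fin 3) (mixedSpace L) → ℂ) (hΘM : ContDiff ℝ ∞ ΘM)
    (haM : ∀ m : ↥(Subgroup.centralizer ({s} : Set ↥(arch (↥(maximalRealSubfield L)) L (IsCMField.complexConj L) 3 (Matrix.diagonal α)))), aM m = ΘM ((((m : ↥(Subgroup.centralizer ({s} : Set ↥(arch (↥(maximalRealSubfield L)) L (IsCMField.complexConj L) 3 (Matrix.diagonal α))))) : ↥(arch (↥(maximalRealSubfield L)) L (IsCMField.complexConj L) 3 (Matrix.diagonal α))) : GL (Fin 3) (mixedSpace L)) : Matrix (Fin 3) (Fin 3) (mixedSpace L)))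
    (Λ : Matrix (Fin 2) (Fin 2) ℂ → Matrix (Fin 3) (Fin 3) (mixedSpace L)) (hΛ : ContDiff ℝ ∞ Λ)
    (hΛb : ∀ b : ↥(unitaryGroupOfForm (starRingEnd ℂ) J), ((((eM.symm (b, 1) : ↥(Subgroup.centralizer ({s} : Set ↥(arch (↥(maximalRealSubfield L)) L (IsCMField.complexConj L) 3 (Matrix.diagonal α))))) : ↥(arch (↥(maximalRealSubfield L)) L (IsCMField.complexConj L) 3 (Matrix.diagonal α))) : GL (Fin 3) (mixedSpace L)) : Matrix (Fin 3) (Fin 3) (mixedSpace L)) = Λ ((b : GL (Fin 2) ℂ) : Matrix (Fin 2) (Fin 2) ℂ))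
    (Rρ : ({w : InfinitePlace L // IsComplex w} → Fin 3 → ℝ) → Matrix (Fin 3) (Fin 3) (mixedSpace L)) (hRρ : ContDiff ℝ ∞ Rρ)
    (hρR : ∀ c, ((((eM.symm (1, ρ c) : ↥(Subgroup.centralizer ({s} : Set ↥(arch (↥(maximalRealSubfield L)) L (IsCMField.complexConj L) 3 (Matrix.diagonal α))))) : ↥(arch (↥(maximalRealSubfield L)) L (IsCMField.complexConj L) 3 (Matrix.diagonal α))) : GL (Fin 3) (mixedSpace L)) : Matrix (Fin 3) (Fin 3) (mixedSpace L)) = Rρ c)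
    (hϑ : ContDiff ℝ ∞ ϑ) :
    ContDiff ℝ ∞ fun c : {w : InfinitePlace L // IsComplex w} → Fin 3 → ℝ => ∫ q : ↥K × ↥(unipotentU (starRingEnd ℂ) J),
        aM (eM.symm (((q.1 : ↥(unitaryGroupOfForm (starRingEnd ℂ) J)) *
          ((⟨hypBlockGL 0 (ϑ c), hypBlockGL_mem_of_eq_over hJ 0 (ϑ c)⟩ : ↥(unitaryGroupOfForm (starRingEnd ℂ) J)) *
            (⟨hypBlockGL (c w 0 / 2) 0, hypBlockGL_mem_of_eq_over hJ (c w 0 / 2) 0⟩ : ↥(unitaryGroupOfForm (starRingEnd ℂ) J)) *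
            (q.2 : ↥(unitaryGroupOfForm (starRingEnd ℂ) J)) *
            (⟨hypBlockGL (c w 0 / 2) 0, hypBlockGL_mem_of_eq_over hJ (c w 0 / 2) 0⟩ : ↥(unitaryGroupOfForm (starRingEnd ℂ) J))) *
          (q.1 : ↥(unitaryGroupOfForm (starRingEnd ℂ) J))⁻¹), ρ c)) ∂(κK.prod μN) := by
  -- the parametrised block function and its smooth ambient reading `f (c, B) = ΘM (Λ B · Rρ c)`
  obtain ⟨F, hF⟩ : ∃ F : ({w : InfinitePlace L // IsComplex w} → Fin 3 → ℝ) → ↥(unitaryGroupOfForm (starRingEnd ℂ) J) → ℂ, F = fun c b => aM (eM.symm (b, ρ c)) := ⟨_, rfl⟩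
  obtain ⟨f, hf⟩ : ∃ f : ({w : InfinitePlace L // IsComplex w} → Fin 3 → ℝ) × Matrix (Fin 2) (Fin 2) ℂ → ℂ, f = fun p => ΘM (Λ p.2 * Rρ p.1) := ⟨_, rfl⟩
  have hfs : ContDiff ℝ ∞ f := by
    rw [hf]
    exact hΘM.comp ((hΛ.comp contDiff_snd).mul (hRρ.comp contDiff_fst))
  have hFf : ∀ c b, F c b = f (c, ((b : GL (Fin 2) ℂ) : Matrix (Fin 2) (Fin 2) ℂ)) := by
    intro c b
    rw [hF, hf]
    dsimp only
    have hsplit : eM.symm (b, ρ c) = eM.symm (b, 1) * eM.symm (1, ρ c) := by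
      rw [← map_mul, Prod.mk_mul_mk, mul_one, one_mul]
    rw [haM, hsplit, Subgroup.coe_mul, Subgroup.coe_mul, Units.val_mul, hΛb, hρR]
  have hS₀ : IsCompact (Prod.fst '' (eM '' tsupport aM)) := (haMs.isCompact.image eM.continuous).image continuous_fst
  have hFS : ∀ c (g : ↥(unitaryGroupOfForm (starRingEnd ℂ) J)), g ∉ Prod.fst '' (eM '' tsupport aM) → F c g = 0 := by
    intro c g hg
    rw [hF]
    by_contra h
    exact hg ⟨(g, ρ c), ⟨eM.symm (g, ρ c), subset_tsupport _ h, eM.apply_symm_apply _⟩, rfl⟩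
  have hG := contDiff_integral_prod_conj_hypBlockGL_half_param hJ κK μN hK F f hfs hFf hS₀ hFS
  have hΘ : ContDiff ℝ ∞ fun c : {w : InfinitePlace L // IsComplex w} → Fin 3 → ℝ => (c, c w 0, ϑ c) :=
    contDiff_id.prodMk ((contDiff_apply_apply ℝ ℝ w 0).prodMk hϑ)
  have h := hG.comp hΘ
  rw [hF] at h
  simpa only [Function.comp_def] using h

include hΨ hγ in
/-- **«(I₂) ACROSS THE REAL WALL, ALL ORDERS» — THE HEAD OF THE (B∞) DRESS (binder form).**  Under ★ (B) p850625's binders (descent `hdesc` off the wall on `U`, block data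
`eM Ψ hΨ`, `Ψ_* μZ = κ • μ`, `μ` in Iwasawa form, joint chart reading `hγ` with `ϑ, ρ` continuous on `U`) AND the smooth readings of §2 (`ΘM`, `Λ`, `Rρ`, `hϑ`), the
wall-extended genuine family **`orbFamGExt L α ν′ a′ (S ∪ {w})` is `C^∞` on `(U ∩ {cof-regular}) ∩ InRegG (slotSign L α) (S ∪ {w})`** — across the real wall `x_w = 0`: on `U ∩ InRegG`
it IS `cof · (C₀κ) · (C • cone chart)` (★ `orbFamGExt_eqOn_realWall_of_block`), the cone chart is smooth (§2) and the cofactor is smooth off the codimension-two corner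
`x_w = 0 ∧ e^{iθ₂} = e^{iθ₁}` and off the OTHER real walls (§1).  Harish-Chandra: `'F_f ∈ C^∞` across the split Cartan's real wall, for the genuine family of `G′_∞`.
[cite: Varadarajan1977, Part I §1.12] [cite: Varadarajan1989, §6.4 Thm 23] [cite: Rogawski1990, §8.2 pp. 118–122] [cite: Shelstad1979, §4 Lemma 4.3 (p. 25)]
[cite: Bouaziz1994IntegralesOrbitales, §3.1 (I₂) p. 579] -/
theorem contDiffOn_orbFamGExt_realWall_of_block_of_smooth (hS' : ∀ w', w' ∈ insert w S → w' ∈ splitChartPlaces L α)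
    (hK : IsCompact (K : Set ↥(unitaryGroupOfForm (starRingEnd ℂ) J))) [IsHaarMeasure κK] [IsHaarMeasure μN] {C : ℝ≥0}
    (hμC : μ = C • Measure.map
      (fun q : ↥K × ↥(unipotentU (starRingEnd ℂ) J) =>
        (QuotientGroup.mk ((q.1 : ↥(unitaryGroupOfForm (starRingEnd ℂ) J)) * (q.2 : ↥(unitaryGroupOfForm (starRingEnd ℂ) J))) : ↥(unitaryGroupOfForm (starRingEnd ℂ) J) ⧸ torusU (starRingEnd ℂ) J))
      (κK.prod μN))
    (hU : IsOpen U) (hϑc : ContinuousOn ϑ U) (hρc : ContinuousOn ρ U)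
    (μZ : Measure (↥(Subgroup.centralizer ({s} : Set ↥(arch (↥(maximalRealSubfield L)) L (IsCMField.complexConj L) 3 (Matrix.diagonal α)))) ⧸ (chartTorusG L α (insert w S)).subgroupOf (Subgroup.centralizer ({s} : Set ↥(arch (↥(maximalRealSubfield L)) L (IsCMField.complexConj L) 3 (Matrix.diagonal α))))))
    {κ : ℝ≥0} (hmap : Measure.map Ψ μZ = κ • μ)
    {aM : ↥(Subgroup.centralizer ({s} : Set ↥(arch (↥(maximalRealSubfield L)) L (IsCMField.complexConj L) 3 (Matrix.diagonal α)))) → ℂ} (haMc : Continuous aM) (haMs : HasCompactSupport aM) {C₀ : ℂ}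
    (hdesc : ∀ c ∈ U, c w 0 ≠ 0 → chartOrbG L α ν' (insert w S) a' c =
      C₀ * ∫ kq, descConj (⟨gprimeTorus L α (insert w S) c, hT (gprimeTorus_mem_chartTorusG L α (insert w S) c)⟩ : ↥(Subgroup.centralizer ({s} : Set ↥(arch (↥(maximalRealSubfield L)) L (IsCMField.complexConj L) 3 (Matrix.diagonal α)))))
          ((chartTorusG L α (insert w S)).subgroupOf (Subgroup.centralizer ({s} : Set ↥(arch (↥(maximalRealSubfield L)) L (IsCMField.complexConj L) 3 (Matrix.diagonal α)))))
          (fun t ht => Subtype.ext (forall_mem_chartTorusG_comm L α (insert w S) c (t : ↥(arch (↥(maximalRealSubfield L)) L (IsCMField.complexConj L) 3 (Matrix.diagonal α))) (Subgroup.mem_subgroupOf.1 ht)))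
          aM kq ∂μZ)
    (ΘM : Matrix (Fin 3) (Fin 3) (mixedSpace L) → ℂ) (hΘM : ContDiff ℝ ∞ ΘM)
    (haM : ∀ m : ↥(Subgroup.centralizer ({s} : Set ↥(arch (↥(maximalRealSubfield L)) L (IsCMField.complexConj L) 3 (Matrix.diagonal α)))), aM m = ΘM ((((m : ↥(Subgroup.centralizer ({s} : Set ↥(arch (↥(maximalRealSubfield L)) L (IsCMField.complexConj L) 3 (Matrix.diagonal α))))) : ↥(arch (↥(maximalRealSubfield L)) L (IsCMField.complexConj L) 3 (Matrix.diagonal α))) : GL (Fin 3) (mixedSpace L)) : Matrix (Fin 3) (Fin 3) (mixedSpace L)))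
    (Λ : Matrix (Fin 2) (Fin 2) ℂ → Matrix (Fin 3) (Fin 3) (mixedSpace L)) (hΛ : ContDiff ℝ ∞ Λ)
    (hΛb : ∀ b : ↥(unitaryGroupOfForm (starRingEnd ℂ) J), ((((eM.symm (b, 1) : ↥(Subgroup.centralizer ({s} : Set ↥(arch (↥(maximalRealSubfield L)) L (IsCMField.complexConj L) 3 (Matrix.diagonal α))))) : ↥(arch (↥(maximalRealSubfield L)) L (IsCMField.complexConj L) 3 (Matrix.diagonal α))) : GL (Fin 3) (mixedSpace L)) : Matrix (Fin 3) (Fin 3) (mixedSpace L)) = Λ ((b : GL (Fin 2) ℂ) : Matrix (Fin 2) (Fin 2) ℂ))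
    (Rρ : ({w : InfinitePlace L // IsComplex w} → Fin 3 → ℝ) → Matrix (Fin 3) (Fin 3) (mixedSpace L)) (hRρ : ContDiff ℝ ∞ Rρ)
    (hρR : ∀ c, ((((eM.symm (1, ρ c) : ↥(Subgroup.centralizer ({s} : Set ↥(arch (↥(maximalRealSubfield L)) L (IsCMField.complexConj L) 3 (Matrix.diagonal α))))) : ↥(arch (↥(maximalRealSubfield L)) L (IsCMField.complexConj L) 3 (Matrix.diagonal α))) : GL (Fin 3) (mixedSpace L)) : Matrix (Fin 3) (Fin 3) (mixedSpace L)) = Rρ c)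
    (hϑ : ContDiff ℝ ∞ ϑ) :
    ContDiffOn ℝ ∞ (orbFamGExt L α ν' a' (insert w S))
      ((U ∩ {c | Complex.exp (c w 0 + c w 2 * I) ≠ Complex.exp (c w 1 * I) ∧ Complex.exp (-c w 0 + c w 2 * I) ≠ Complex.exp (c w 1 * I) ∧
          ∀ w', w' ∈ S → w' ≠ w → c w' 0 ≠ 0}) ∩ InRegG (slotSign L α) (insert w S)) := by
  haveI : CompactSpace ↥K := isCompact_iff_compactSpace.mp hK
  have heq := orbFamGExt_eqOn_realWall_of_block L α ν' a' S w s hT hJ κK μN μ eM Ψ hΨ hγ hS' hK hμC hU hϑc hρc μZ hmap haMc haMs hdesc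
  have hcone := contDiff_coneChart_of_smooth L α w s hJ κK μN eM hK haMs ΘM hΘM haM Λ hΛ hΛb Rρ hRρ hρR hϑ
  have hH : ContDiffOn ℝ ∞ (fun c : {w : InfinitePlace L // IsComplex w} → Fin 3 → ℝ =>
        ((((‖Complex.exp (c w 0 + c w 2 * Complex.I) - Complex.exp (c w 1 * Complex.I)‖ * ‖Complex.exp (-c w 0 + c w 2 * Complex.I) - Complex.exp (c w 1 * Complex.I)‖ : ℝ) : ℂ) *
          ∏ w' ∈ Finset.univ.erase w,
            (if w' ∈ insert w S then
                ((|Real.exp (c w' 0) - Real.exp (-c w' 0)| *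
                  ‖Complex.exp (c w' 0 + c w' 2 * Complex.I) - Complex.exp (c w' 1 * Complex.I)‖ * ‖Complex.exp (-c w' 0 + c w' 2 * Complex.I) - Complex.exp (c w' 1 * Complex.I)‖ : ℝ) : ℂ)
              else (1 - (Circle.exp (c w' 1 - c w' 0) : ℂ)) * (1 - (Circle.exp (c w' 2 - c w' 0) : ℂ)) * (1 - (Circle.exp (c w' 2 - c w' 1) : ℂ))))) *
          ((C₀ * ((κ : ℝ) : ℂ)) * ((C : ℝ) • ∫ q : ↥K × ↥(unipotentU (starRingEnd ℂ) J),
        aM (eM.symm (((q.1 : ↥(unitaryGroupOfForm (starRingEnd ℂ) J)) *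
          ((⟨hypBlockGL 0 (ϑ c), hypBlockGL_mem_of_eq_over hJ 0 (ϑ c)⟩ : ↥(unitaryGroupOfForm (starRingEnd ℂ) J)) *
            (⟨hypBlockGL (c w 0 / 2) 0, hypBlockGL_mem_of_eq_over hJ (c w 0 / 2) 0⟩ : ↥(unitaryGroupOfForm (starRingEnd ℂ) J)) *
            (q.2 : ↥(unitaryGroupOfForm (starRingEnd ℂ) J)) *
            (⟨hypBlockGL (c w 0 / 2) 0, hypBlockGL_mem_of_eq_over hJ (c w 0 / 2) 0⟩ : ↥(unitaryGroupOfForm (starRingEnd ℂ) J))) *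
          (q.1 : ↥(unitaryGroupOfForm (starRingEnd ℂ) J))⁻¹), ρ c)) ∂(κK.prod μN))))
      {c | Complex.exp (c w 0 + c w 2 * I) ≠ Complex.exp (c w 1 * I) ∧ Complex.exp (-c w 0 + c w 2 * I) ≠ Complex.exp (c w 1 * I) ∧
          ∀ w', w' ∈ S → w' ≠ w → c w' 0 ≠ 0} :=
    (contDiffOn_splitCofactor S w).mul (contDiffOn_const.mul (hcone.const_smul (C : ℝ)).contDiffOn)
  refine (hH.mono fun c hc => hc.1.2).congr fun c hc => ?_
  exact heq ⟨hc.1.1, hc.2⟩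

end JointChartSmooth

end Literature.NumberTheory.Rogawski1990

end
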